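import Summits.CriticalPhenomena.CardyFormulaZ2.Theorems.CardyWhiteToColouredNoiseDiscretisationCrossing
import Summits.CriticalPhenomena.CardyFormulaZ2.Theorems.CardyWhiteToColouredNoiseDiscretisationNormalForm
import Summits.CriticalPhenomena.CardyFormulaZ2.Theorems.CardyMagicRigidityLoopsToCrossingsStubDiscreteCrossingOfPathIn
import Literature.Probability.Percolation.LatticeShadowOfPath
import Literature.Topology.PlaneTopology.JordanCurveProofs
import Literature.Topology.PlaneTopology.AnnulusArcs

/-!
# Crossings of `R̄` by super-level sets of a continuous field (part 3): continuum ⇒ discrete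

Helper file for item `NoiseDiscretisation` (stmt-CriticalPhenomena-4598) of route
`CardyWhiteToColoured` (`CardyFormulaZ2`).

`discreteCrossing_of_posCross`: let `R = (Ω; arcs 0–3)` be a conformal rectangle, `F` continuous
and suppose `PosCross[R, F, c]` (a path in `closure Ω` from `arc 0` to `arc 2` with `F > c`). Then
for all small `δ > 0`, every bond configuration containing all inner edges `e` (both mesh
end-points in `Ω`) with `F(m_δ e) > c` realises Smirnov's crossing event
`discreteCrossing Ω δ (arc 0) (arc 2)` of G02. Proof: put the path in normal form
(`exists_path_inner_of_posCross`: end-points interior points `a'`, `c'` of the two arcs, interior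
of the path inside `Ω`), prolong it at both ends by short segments to exterior points `e₀`, `e₂`
of the Jordan curve near `a'`, `c'` (`frontier_subset_closure_exterior`, Jordan curve theorem),
shadow the prolonged path by a walk of `ℤ²` at mesh `δ` (`exists_walk_near_path`,
Schramm–Smirnov face chains), and feed the walk to the bond port of the Bollobás–Riordan sandwich
(`stub_discreteCrossing_of_pathIn` of crux `LoopsToCrossings`, line `oracle-sandwich`): its
off-`Ω` sites are near `arc 0 ∪ arc 2`, its in-`Ω` sites keep one mesh off `arc 1 ∪ arc 3`, and
all its inner edges have their midpoint within `5δ/2` of the path, where `F > c`.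

References: B. Bollobás, O. Riordan, *Percolation* (2006), Ch. 7 Claim 19; O. Schramm, S. Smirnov,
Ann. Probab. 39 (2011), proof of Lemma 6.1; S. Smirnov, C. R. Acad. Sci. Paris 333 (2001), §2.
-/

noncomputable section

namespace Summit.CriticalPhenomena.CardyFormulaZ2.Theorems

namespace WhiteToColoured

open Set Metric Filter Topology
open Literature.Probability.LatticeModels Literature.Probability.Percolation
open Literature.Probability.RandomPlanarGeometry
open Summit.CriticalPhenomena.CardyFormulaZ2.Cruxes.LoopsToCrossings.OracleSandwich
  (stub_discreteCrossing_of_pathIn)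

/-- `PosCross[R, F, c]`: some path in `closure R.carrier` from `arc 0` to `arc 2` has `F > c`. -/
local notation3 "PosCross[" R ", " F ", " c "]" =>
  ∃ x ∈ MarkedDomain.arc R (0 : Fin 4), ∃ y ∈ MarkedDomain.arc R (2 : Fin 4), ∃ γ : Path x y,
    ∀ t, γ t ∈ closure (JordanDomain.carrier (MarkedDomain.toJordanDomain R)) ∧
      (c : ℝ) < (F : ℂ → ℝ) (γ t)

/-- `InnerE[Ω, δ]`: the inner lattice edges at mesh `δ` (both mesh end-points in `Ω`). -/
local notation3 "InnerE[" Ω ", " δ "]" =>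
  {e : Sym2 (Site 2) | e ∈ (zdGraph 2).edgeSet ∧ ∀ v ∈ e, meshPoint δ v ∈ (Ω : Set ℂ)}

/-- An open lattice walk is a `PathIn` of `openGraph ω ⊓ ℤ²` inside its own support. -/
theorem pathIn_of_walk {ω : BondConfig (Site 2)} {u w : Site 2} (π : (zdGraph 2).Walk u w)
    (hπ : ∀ e ∈ π.edges, e ∈ ω) :
    PathIn (openGraph ω ⊓ zdGraph 2) {x | x ∈ π.support} u w := by
  induction π with
  | nil => exact PathIn.refl (by simp)
  | @cons a b c hadj W ih =>
    have hW : PathIn (openGraph ω ⊓ zdGraph 2) {x | x ∈ (SimpleGraph.Walk.cons hadj W).support} b c :=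
      (ih fun e he => hπ e (by simp [he])).mono fun x hx => by
        simp only [SimpleGraph.Walk.support_cons, List.mem_cons, mem_setOf_eq] at hx ⊢
        exact Or.inr hx
    refine ⟨by simp, Relation.ReflTransGen.head ⟨?_, hW.1⟩ hW.2⟩
    refine (SimpleGraph.inf_adj _ _ _ _).2 ⟨(openGraph_adj _ _ _).2 ⟨hπ _ (by simp), hadj.ne⟩, hadj⟩

/-- **Continuum ⇒ discrete.** See the module docstring. -/
theorem discreteCrossing_of_posCross (R : ConformalRectangle) {F : ℂ → ℝ} (hF : Continuous F)
    {c : ℝ} (h : PosCross[R, F, c]) :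
    ∃ δ₁ > 0, ∀ δ : ℝ, 0 < δ → δ < δ₁ → ∀ ω : BondConfig (Site 2),
      (∀ e ∈ InnerE[R.carrier, δ], c < F (medialPoint δ e) → e ∈ ω) →
      ω ∈ discreteCrossing R.carrier δ (R.arc 0) (R.arc 2) := by
  set Ω := R.carrier with hΩdef
  have hΩo : IsOpen Ω := R.isOpen
  -- Step 1: normal form of the crossing path inside `U = {F > c}`
  set U : Set ℂ := {z | c < F z} with hU
  have hUo : IsOpen U := isOpen_lt continuous_const hF
  obtain ⟨x, hx, y, hy, γ, hγ⟩ := h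
  obtain ⟨s₀, hs₀, s₂, hs₂, hrest⟩ :=
    exists_path_inner_of_posCross R hUo hx hy γ fun t => ⟨(hγ t).1, (hγ t).2⟩
  -- Step 2: isolation radii of the interior arc points
  obtain ⟨r₀, hr₀, -, hr₀'⟩ := R.exists_pos_forall_mem_arc_of_dist_lt 0 hs₀
  obtain ⟨r₂, hr₂, -, hr₂'⟩ := R.exists_pos_forall_mem_arc_of_dist_lt 2 hs₂
  have ha'A : R.boundary s₀ ∈ R.arc 0 := ⟨s₀, ⟨hs₀.1.le, hs₀.2.le⟩, rfl⟩
  have hc'A : R.boundary s₂ ∈ R.arc 2 := ⟨s₂, ⟨hs₂.1.le, hs₂.2.le⟩, rfl⟩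
  have ha'fr : R.boundary s₀ ∈ frontier Ω := R.boundary_mem_frontier s₀
  have hc'fr : R.boundary s₂ ∈ frontier Ω := R.boundary_mem_frontier s₂
  -- name the end-points (all later hypotheses are stated with `a'`, `c'`)
  set a' := R.boundary s₀ with ha'
  set c' := R.boundary s₂ with hc'
  obtain ⟨Γ, hΓ, hΓin⟩ := hrest
  have ha'Γ : a' ∈ range Γ := ⟨0, Γ.source⟩
  have hc'Γ : c' ∈ range Γ := ⟨1, Γ.target⟩
  -- Step 3: a uniform margin `η` around the path
  obtain ⟨η, hη, hηU⟩ := (isCompact_range Γ.continuous).exists_thickening_subset_open hUo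
    (range_subset_iff.2 fun t => (hΓ t).2)
  have hFU : ∀ z p, p ∈ range Γ → dist z p < η → c < F z := fun z p hp hzp =>
    hηU (mem_thickening_iff.2 ⟨p, hp, hzp⟩)
  -- Step 4: the sandwich stub data
  obtain ⟨δA, hδA, t₀, ht₀, hA⟩ := stub_discreteCrossing_of_pathIn R
  -- the working radius `r`
  set r := min (min r₀ r₂) (min η t₀) / 2 with hr
  have hrpos : 0 < r := by positivity
  have hrr₀ : r ≤ r₀ / 2 := by
    have : min (min r₀ r₂) (min η t₀) ≤ r₀ := (min_le_left _ _).trans (min_le_left _ _)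
    rw [hr]; linarith
  have hrr₂ : r ≤ r₂ / 2 := by
    have : min (min r₀ r₂) (min η t₀) ≤ r₂ := (min_le_left _ _).trans (min_le_right _ _)
    rw [hr]; linarith
  have hrη : r ≤ η / 2 := by
    have : min (min r₀ r₂) (min η t₀) ≤ η := (min_le_right _ _).trans (min_le_left _ _)
    rw [hr]; linarith
  have hrt₀ : r ≤ t₀ := by
    have : min (min r₀ r₂) (min η t₀) ≤ t₀ := (min_le_right _ _).trans (min_le_right _ _)
    rw [hr]; linarith
  -- Step 5: split the path: ends near `a'`, `c'`, compact middle `K ⊆ Ω`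
  obtain ⟨τ₁, hτ₁, hτ₁d⟩ : ∃ τ₁ > 0, ∀ t : unitInterval, dist t 0 < τ₁ → dist (Γ t) a' < r / 4 := by
    have hc := Γ.continuous.continuousAt (x := 0)
    rw [Metric.continuousAt_iff] at hc
    obtain ⟨τ₁, hτ₁, h⟩ := hc (r / 4) (by positivity)
    exact ⟨τ₁, hτ₁, fun t ht => by have := h ht; rwa [Γ.source] at this⟩
  obtain ⟨τ₂, hτ₂, hτ₂d⟩ : ∃ τ₂ > 0, ∀ t : unitInterval, dist t 1 < τ₂ → dist (Γ t) c' < r / 4 := by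
    have hc := Γ.continuous.continuousAt (x := 1)
    rw [Metric.continuousAt_iff] at hc
    obtain ⟨τ₂, hτ₂, h⟩ := hc (r / 4) (by positivity)
    exact ⟨τ₂, hτ₂, fun t ht => by have := h ht; rwa [Γ.target] at this⟩
  set τ := min τ₁ τ₂ with hτ
  have hτpos : 0 < τ := lt_min hτ₁ hτ₂
  set K : Set ℂ := Γ '' {t : unitInterval | τ ≤ (t : ℝ) ∧ (t : ℝ) ≤ 1 - τ} with hK
  have hKc : IsCompact K := by
    refine (IsClosed.isCompact ?_).image Γ.continuous
    exact (isClosed_le continuous_const continuous_subtype_val).inter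
      (isClosed_le continuous_subtype_val continuous_const)
  have hKΩ : K ⊆ Ω := by
    rintro _ ⟨t, ⟨ht1, ht2⟩, rfl⟩
    exact hΓin t (by intro h0; rw [h0] at ht1; linarith) (by intro h1; rw [h1] at ht2; linarith)
  have hKΓ : K ⊆ range Γ := image_subset_range _ _
  obtain ⟨d, hd, hdΩ⟩ := hKc.exists_thickening_subset_open hΩo hKΩ
  have hballK : ∀ p ∈ K, ∀ z, dist z p < d → z ∈ Ω := fun p hp z hz =>
    hdΩ (mem_thickening_iff.2 ⟨p, hp, hz⟩)
  -- classification of the points of the path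
  have hclassΓ : ∀ t : unitInterval, dist (Γ t) a' < r / 4 ∨ Γ t ∈ K ∨ dist (Γ t) c' < r / 4 := by
    intro t
    by_cases h1 : (t : ℝ) < τ
    · left
      refine hτ₁d t ?_
      rw [Subtype.dist_eq, Real.dist_eq, show ((0 : unitInterval) : ℝ) = 0 from rfl, sub_zero,
        abs_of_nonneg t.2.1]
      exact h1.trans_le (min_le_left _ _)
    by_cases h2 : 1 - τ < (t : ℝ)
    · right; right
      refine hτ₂d t ?_
      rw [Subtype.dist_eq, Real.dist_eq, show ((1 : unitInterval) : ℝ) = 1 from rfl, abs_lt]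
      constructor <;> linarith [t.2.2, min_le_right τ₁ τ₂]
    · right; left
      exact ⟨t, ⟨not_lt.1 h1, not_lt.1 h2⟩, rfl⟩
  -- Step 6: exterior points near `a'` and `c'`
  have hext : ∀ p ∈ frontier Ω, ∃ e ∉ closure Ω, dist p e < r / 4 ∧
      ∃ ρ > 0, ball e ρ ⊆ (closure Ω)ᶜ := by
    intro p hp
    have hpc : p ∈ closure (closure Ω)ᶜ :=
      R.toJordanDomain.frontier_subset_closure_exterior
        Literature.Topology.PlaneTopology.JordanCurveTheorem_holds hp
    obtain ⟨e, he, hpe⟩ := Metric.mem_closure_iff.1 hpc (r / 4) (by positivity)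
    obtain ⟨ρ, hρ, hball⟩ := Metric.isOpen_iff.1 isClosed_closure.isOpen_compl e he
    exact ⟨e, he, hpe, ρ, hρ, hball⟩
  obtain ⟨e₀, he₀, hde₀, ρ₀, hρ₀, hball₀⟩ := hext a' ha'fr
  obtain ⟨e₂, he₂, hde₂, ρ₂, hρ₂, hball₂⟩ := hext c' hc'fr
  -- Step 7: the mesh threshold
  refine ⟨min (min δA (min ρ₀ ρ₂ / 3)) (min (d / 4) (r / 12)), by positivity, ?_⟩
  intro δ hδ hδlt ω hω
  have hδA' : δ < δA := hδlt.trans_le ((min_le_left _ _).trans (min_le_left _ _))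
  have hδρ₀ : 3 * δ < ρ₀ := by
    have : min (min δA (min ρ₀ ρ₂ / 3)) (min (d / 4) (r / 12)) ≤ min ρ₀ ρ₂ / 3 :=
      (min_le_left _ _).trans (min_le_right _ _)
    linarith [min_le_left ρ₀ ρ₂, hδlt]
  have hδρ₂ : 3 * δ < ρ₂ := by
    have : min (min δA (min ρ₀ ρ₂ / 3)) (min (d / 4) (r / 12)) ≤ min ρ₀ ρ₂ / 3 :=
      (min_le_left _ _).trans (min_le_right _ _)
    linarith [min_le_right ρ₀ ρ₂, hδlt]
  have hδd : 4 * δ < d := by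
    have : min (min δA (min ρ₀ ρ₂ / 3)) (min (d / 4) (r / 12)) ≤ d / 4 :=
      (min_le_right _ _).trans (min_le_left _ _)
    linarith [hδlt]
  have hδr : 12 * δ < r := by
    have : min (min δA (min ρ₀ ρ₂ / 3)) (min (d / 4) (r / 12)) ≤ r / 12 :=
      (min_le_right _ _).trans (min_le_right _ _)
    linarith [hδlt]
  -- the enlarged configuration: open all non-inner edges
  set ω' : BondConfig (Site 2) := ω ∪ (InnerE[Ω, δ])ᶜ with hω'
  have hωω' : ω ∩ InnerE[Ω, δ] = ω' ∩ InnerE[Ω, δ] := by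
    ext e
    simp only [hω', mem_inter_iff, mem_union, mem_compl_iff]
    tauto
  rw [mem_discreteCrossing_iff_of_inter_innerE_eq hωω']
  -- Step 8: the guide path `e₀ → a' → (Γ) → c' → e₂` and its lattice shadow
  let G : Path e₀ e₂ := (Path.segment e₀ a').trans (Γ.trans (Path.segment c' e₂))
  obtain ⟨u, w, π, hu, hw, -, -, hπ⟩ := exists_walk_near_path hδ G.continuous_extend.continuousOn
  rw [G.extend_zero] at hu
  rw [G.extend_one] at hw
  -- every point of the guide path is near `a'`, in `K`, or near `c'`
  have hclass : ∀ s : ℝ, dist (G.extend s) a' ≤ r / 4 ∨ G.extend s ∈ K ∨ dist (G.extend s) c' ≤ r / 4 := by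
    intro s
    have hmem : G.extend s ∈ range G := by
      rw [← G.extend_range]; exact mem_range_self s
    rw [Path.trans_range, Path.trans_range, Path.range_segment, Path.range_segment] at hmem
    rcases hmem with hm | hm | hm
    · left; exact (Literature.Topology.PlaneTopology.dist_le_of_mem_segment_center hm).trans (by rw [dist_comm]; exact hde₀.le)
    · obtain ⟨t, ht⟩ := hm
      rw [← ht]
      rcases hclassΓ t with h1 | h2 | h3
      · exact Or.inl h1.le
      · exact Or.inr (Or.inl h2)
      · exact Or.inr (Or.inr h3.le)
    · right; right
      rw [segment_symm] at hm
      exact (Literature.Topology.PlaneTopology.dist_le_of_mem_segment_center hm).trans (by rw [dist_comm]; exact hde₂.le)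
  -- `F > c` within `5δ/2` of the guide path
  have hFnear : ∀ z (s : ℝ), dist z (G.extend s) ≤ 5 * δ / 2 → c < F z := by
    intro z s hz
    rcases hclass s with h1 | h2 | h3
    · exact hFU z a' ha'Γ (by linarith [dist_triangle z (G.extend s) a'])
    · exact hFU z _ (hKΓ h2) (by linarith)
    · exact hFU z c' hc'Γ (by linarith [dist_triangle z (G.extend s) c'])
  -- arcs are off `Ω` and nonempty
  have harcΩ : ∀ (j : Fin 4), ∀ z ∈ R.arc j, z ∉ Ω := fun j z hz hzΩ =>
    (R.toJordanDomain.disjoint_carrier_frontier).le_bot ⟨hzΩ, R.arc_subset_frontier j hz⟩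
  have harcne : ∀ j : Fin 4, (R.arc j).Nonempty := fun j => ⟨_, R.pt_mem_arc_self j⟩
  -- distance bookkeeping for the sites of the shadow
  have hsite : ∀ v ∈ π.support,
      (dist (meshPoint δ v) a' ≤ r / 4 + 2 * δ) ∨
      (meshPoint δ v ∈ Ω ∧ ∀ j : Fin 4, 2 * δ < infDist (meshPoint δ v) (R.arc j)) ∨
      (dist (meshPoint δ v) c' ≤ r / 4 + 2 * δ) := by
    intro v hv
    obtain ⟨s, -, hs⟩ := hπ v hv
    rcases hclass s with h1 | h2 | h3
    · left; linarith [dist_triangle (meshPoint δ v) (G.extend s) a']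
    · right; left
      refine ⟨hballK _ h2 _ (by linarith), fun j => ?_⟩
      refine lt_of_lt_of_le (by linarith : 2 * δ < d - 2 * δ) ((le_infDist (harcne j)).2 ?_)
      intro z hz
      by_contra hlt
      push Not at hlt
      exact harcΩ j z hz (hballK _ h2 z (by
        linarith [dist_triangle z (meshPoint δ v) (G.extend s), dist_comm z (meshPoint δ v)]))
    · right; right; linarith [dist_triangle (meshPoint δ v) (G.extend s) c']
  -- lower bounds on distances to the other arcs near `a'` and near `c'`
  have hfar₀ : ∀ z, dist z a' ≤ r / 4 + 2 * δ → ∀ j : Fin 4, j ≠ 0 → δ < infDist z (R.arc j) := by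
    intro z hz j hj
    refine lt_of_lt_of_le (by linarith : δ < r₀ - (r / 4 + 2 * δ)) ((le_infDist (harcne j)).2 ?_)
    intro q hq
    have := hr₀' j hj q hq
    linarith [dist_triangle q z a', dist_comm q z]
  have hfar₂ : ∀ z, dist z c' ≤ r / 4 + 2 * δ → ∀ j : Fin 4, j ≠ 2 → δ < infDist z (R.arc j) := by
    intro z hz j hj
    refine lt_of_lt_of_le (by linarith : δ < r₂ - (r / 4 + 2 * δ)) ((le_infDist (harcne j)).2 ?_)
    intro q hq
    have := hr₂' j hj q hq
    linarith [dist_triangle q z c', dist_comm q z]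
  -- Step 9: apply the sandwich stub to `ω'`, the support of the shadow, and its end-points
  refine hA δ r hδ hδA' hrpos.le hrt₀ ω' {v | v ∈ π.support} u w ?_ ?_ ?_ ?_ ?_ ?_
    (pathIn_of_walk π ?_)
  · -- off-`Ω` sites are near `arc 0` or `arc 2`
    intro v hv hvΩ
    rcases hsite v hv with h1 | h2 | h3
    · left
      refine (infDist_le_dist_of_mem ha'A).trans ?_
      linarith
    · exact absurd h2.1 hvΩ
    · right
      refine (infDist_le_dist_of_mem hc'A).trans ?_
      linarith
  · -- in-`Ω` sites keep one mesh off `arc 1 ∪ arc 3`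
    intro v hv _
    rcases hsite v hv with h1 | h2 | h3
    · exact ⟨hfar₀ _ h1 1 (by decide), hfar₀ _ h1 3 (by decide)⟩
    · exact ⟨by linarith [h2.2 1], by linarith [h2.2 3]⟩
    · exact ⟨hfar₂ _ h3 1 (by decide), hfar₂ _ h3 3 (by decide)⟩
  · -- `δu ∉ Ω`
    intro huΩ
    have : meshPoint δ u ∈ ball e₀ ρ₀ := by rw [mem_ball]; linarith
    exact hball₀ this (subset_closure huΩ)
  · -- `δu` is near `arc 0`
    refine (infDist_le_dist_of_mem ha'A).trans ?_
    linarith [dist_triangle (meshPoint δ u) e₀ a', dist_comm a' e₀]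
  · -- `δw ∉ Ω`
    intro hwΩ
    have : meshPoint δ w ∈ ball e₂ ρ₂ := by rw [mem_ball]; linarith
    exact hball₂ this (subset_closure hwΩ)
  · -- `δw` is near `arc 2`
    refine (infDist_le_dist_of_mem hc'A).trans ?_
    linarith [dist_triangle (meshPoint δ w) e₂ c', dist_comm c' e₂]
  · -- every edge of the shadow is open in `ω'`
    intro e he
    by_cases hei : e ∈ InnerE[Ω, δ]
    · left
      refine hω e hei ?_
      -- the midpoint of `e` is within `5δ/2` of the guide path
      induction e using Sym2.ind with
      | h p q =>
        have hp : p ∈ π.support := π.fst_mem_support_of_mem_edges he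
        have hadj : (zdGraph 2).Adj p q := π.adj_of_mem_edges he
        obtain ⟨s, -, hs⟩ := hπ p hp
        refine hFnear _ s ?_
        calc dist (medialPoint δ s(p, q)) (G.extend s)
            ≤ dist (medialPoint δ s(p, q)) (meshPoint δ p) + dist (meshPoint δ p) (G.extend s) :=
              dist_triangle _ _ _
          _ ≤ δ / 2 + 2 * δ := by
              gcongr
              rw [dist_comm]
              exact dist_medialPoint_le_of_mem_segment hδ hadj (left_mem_segment ℝ _ _)
          _ = 5 * δ / 2 := by ring
    · right; exact hei

end WhiteToColoured

end Summit.CriticalPhenomena.CardyFormulaZ2.Theorems
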